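import Summits.CriticalPhenomena.PercolationContinuityZ3.Theorems.Transplant.KNParaChainRun
import HarnessLib

/-!
# N2 (frames-only node `SamePDropOfSkeletonFrm₁`, OPEN), LEVEL 1, (C) column: the PARKING PHASE of a forward-only corridor — `ChainPara.ParkPrm`
# (forward strides into a STATIONARY terminal slab: contacts whose face box already lies in the next core PARK (far-contact clause), contacts behind
# STRIDE; the along-extent of the cores CONTRACTS by `sLo − 2·ea − ρ` per step down to `sHi + ρ − 1`, the far edge creeps by `ea + ρ`, the transverse
# window grows by `eb + ρ + |d|`) — pure `ℤ`, the twin of `ChainPara.RunPrm` (KNParaChainRun) for the along-ARRIVAL of an oriented corridor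

builds on p205010 (kernel theorem, internal audit signed; external expert review pending) — nothing in this file uses p205010; nothing here is a
claim about the open node `SamePDropOfSkeletonFrm₁`.
Lane `prim-bschramm`, seat `prim-bschramm-p5` (gen 15; (C) lineage; design: HOME/prim-bschramm-p5-g15/B9-CORRIDOR-BOX.md §2 'parking', §A3/§A5 —
under orientation ((R-12)) a corridor has no two-signed localisation rounds (`LocPrm.dir`), so its along-arrival into a box is by ABSORPTION into a
stationary slab: walkers arrive at different steps and park); helper file (`--supports stmt-CriticalPhenomena-4575`).

WHY.  `RunPrm`'s cores translate forward by `[sLo, sHi]` per step and every point of the enlarged core must stride (`RunPrm.route`); a TARGET BOX of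
along-depth ≈ one stride cannot be entered that way by a source of larger along-extent.  Here the next core keeps its FAR edge (up to the creep
`ea + ρ` forced by the level slack and the face radius) and raises its NEAR edge by `sLo − ea`, until the extent is `sHi + ρ − 1`; a point `v` of the
enlarged core `k` is served EITHER by the far-contact clause (`IsFar k v_a`: its face box `v ± ρ` lies in core `k+1`) OR by a steered stride landing in
core `k+1` — exactly the disjunction the (S0) kit clause `kitClauseF`'s near-contact input offers (`(∃ u ∈ Λc (ctCtr x) kz, u ∈ T) ∨ route`).
* §1 `ParkPrm`, `ParkOK`; §2 `aHi/aLo/g/bLo/bHi`, `InCore/InEnl/InRegion/InPrism`, `steer`, `InPiece`, `IsFar`;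
* §3 `inEnl_of_inCore`, `inRegion_of_inEnl`, **`inRegion_of_link`**, **`box_subset_of_isFar`** (far contacts park), **`inCore_succ_of_landing`** (striders land),
  **`route`** (the dichotomy), `inRegion_of_inCore_succ`, `aLo_ge`, `inPrism_of_inRegion`, `inCore_far_corner` (cores nonempty), `inCore_zero_iff`;
* §4 **`extent_succ`**, **`extent_le`** (the along-extent contracts: `aHi k − aLo k ≤ max (extent₀ − k·(sLo − 2ea − ρ)) (sHi + ρ − 1)`).
[cite: KozmaNitzan2024, §4 Lemma 11 (pp. 22–23: the straight run), Lemma 12 (pp. 23–25: arrival in the target box)]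
[cite: MartineauTassion2017, §4.3 Lemma 4.2 (piece choice by position; arXiv:1312.1946 pp. 12–14)]
-/

namespace Summit.CriticalPhenomena.PercolationContinuityZ3.Theorems.Transplant

namespace ChainPara

/-! ## §1 Parameters and admissibility -/

/-- **Parameters of a parking phase**: stride progress `[sLo, sHi]`, transverse drift `d`, landing pieces `[0, Pp]` / `[−Pm, 0]`, siting slacks
`(ea, eb)`, link box `La × Lb`, face-box radius `ρ` (a contact whose `ρ`-box lies in the next core parks), core `0` = `[aLo0, A] × [−Wm, Wp]`, steps
`0, …, N`. [this work] -/
structure ParkPrm where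
  /-- minimal along-progress of one stride -/
  sLo : ℤ
  /-- maximal along-progress of one stride -/
  sHi : ℤ
  /-- transverse drift of one stride -/
  d : ℤ
  /-- the `τ = 1` landing piece is `[0, Pp]` (transverse, relative to the drifted position) -/
  Pp : ℕ
  /-- the `τ = −1` landing piece is `[−Pm, 0]` -/
  Pm : ℕ
  /-- along siting slack per step (seed centre vs contact, level depth) -/
  ea : ℕ
  /-- transverse siting slack per step -/
  eb : ℕ
  /-- along half-size of the link box of one stride about the seed centre -/
  La : ℕ
  /-- transverse half-size of the link box -/
  Lb : ℕ
  /-- planar radius of a contact's face box (the far-contact test) -/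
  ρ : ℕ
  /-- along lower bound of core `0` -/
  aLo0 : ℤ
  /-- along upper bound of core `0` (the slab's far edge at step `0`) -/
  A : ℤ
  /-- lower transverse half-width of core `0` -/
  Wm : ℕ
  /-- upper transverse half-width of core `0` -/
  Wp : ℕ
  /-- the phase has steps `0, …, N` -/
  N : ℕ

/-- **Admissible parking parameters**: forward strides of positive maximal progress, the along slack at most the minimal progress, the stride and the
creep inside the link box, each landing piece at most half the window, the parking condition `2ea + ρ ≤ sLo`, core `0` nonempty. [this work] -/
structure ParkOK (P : ParkPrm) : Prop where
  /-- strides do not go backwards -/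
  hs0 : 0 ≤ P.sLo
  /-- the stride interval is an interval -/
  hs : P.sLo ≤ P.sHi
  /-- strides make progress -/
  hs1 : 1 ≤ P.sHi
  /-- the along slack is at most the minimal progress (the near edge never recedes below its floor) -/
  hea : (P.ea : ℤ) ≤ P.sLo
  /-- the PARKING CONDITION: one stride's minimal progress beats twice the along slack plus the face radius (the extent contracts) -/
  hcontr : 2 * (P.ea : ℤ) + P.ρ ≤ P.sLo
  /-- one stride's landing lies in its link box (along) -/
  hsL : P.sHi ≤ P.La
  /-- the far-edge creep lies in the link box (along) -/
  hρa : P.ρ ≤ P.La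
  /-- the drift and the face radius lie in the link box (transverse) -/
  hρd : (P.ρ : ℤ) + |P.d| ≤ P.Lb
  /-- the lower piece is at most half the window -/
  hPm : 2 * P.Pm ≤ P.Wm + P.Wp
  /-- the upper piece is at most half the window -/
  hPp : 2 * P.Pp ≤ P.Wm + P.Wp
  /-- core `0` is nonempty along -/
  h0 : P.aLo0 ≤ P.A

namespace ParkPrm

variable (P : ParkPrm)

/-! ## §2 Cores, enlarged cores, regions, the prism, steering, pieces, the far test -/

/-- Upper along-bound of core `k`: the slab's far edge, creeping by `ea + ρ` per step. [this work] -/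
def aHi (k : ℕ) : ℤ := P.A + (k : ℤ) * (P.ea + P.ρ)

variable {P} in
/-- Lower along-bound of core `k`: raised by `sLo − ea` per step until one stride below the far edge. [this work] -/
def aLo (P : ParkPrm) : ℕ → ℤ
  | 0 => P.aLo0
  | k + 1 => min (aLo P k + P.sLo - P.ea) (P.aHi k + P.ea + 1 - P.sHi)

/-- The transverse growth per step: slack, face radius and drift (parked contacts do not drift). [this work] -/
def g : ℕ := P.eb + P.ρ + P.d.natAbs

/-- Lower transverse bound of core `k`. [this work] -/
def bLo (k : ℕ) : ℤ := -(P.Wm : ℤ) - (k : ℤ) * P.g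

/-- Upper transverse bound of core `k`. [this work] -/
def bHi (k : ℕ) : ℤ := (P.Wp : ℤ) + (k : ℤ) * P.g

/-- The recursion for `aLo`. [folklore] -/
theorem aLo_succ (k : ℕ) : P.aLo (k + 1) = min (P.aLo k + P.sLo - P.ea) (P.aHi k + P.ea + 1 - P.sHi) := rfl

/-- `aLo 0 = aLo0`. [folklore] -/
@[simp] theorem aLo_zero : P.aLo 0 = P.aLo0 := rfl

/-- The far edge advances by `ea + ρ`. [folklore] -/
theorem aHi_succ (k : ℕ) : P.aHi (k + 1) = P.aHi k + P.ea + P.ρ := by unfold aHi; push_cast; ring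

/-- `aHi 0 = A`. [folklore] -/
@[simp] theorem aHi_zero : P.aHi 0 = P.A := by simp [aHi]

/-- The transverse bounds advance by `g`. [folklore] -/
theorem bLo_succ (k : ℕ) : P.bLo (k + 1) = P.bLo k - P.g := by unfold bLo; push_cast; ring

/-- The transverse bounds advance by `g`. [folklore] -/
theorem bHi_succ (k : ℕ) : P.bHi (k + 1) = P.bHi k + P.g := by unfold bHi; push_cast; ring

/-- `g = eb + ρ + |d|` (as integers). [folklore] -/
theorem g_eq : (P.g : ℤ) = P.eb + P.ρ + |P.d| := by
  unfold g; push_cast; ring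

/-- **Core `k`** (positions of the contacts after `k` parking steps). [cite: KozmaNitzan2024, §4 Lemma 12 (pp. 23–25: the target box)] -/
def InCore (k : ℕ) (a b : ℤ) : Prop := P.aLo k ≤ a ∧ a ≤ P.aHi k ∧ P.bLo k ≤ b ∧ b ≤ P.bHi k

/-- **Enlarged core `k`** (seed centres sited within `(ea, eb)` of a contact of core `k`). [this work] -/
def InEnl (k : ℕ) (a b : ℤ) : Prop :=
  P.aLo k - P.ea ≤ a ∧ a ≤ P.aHi k + P.ea ∧ P.bLo k - P.eb ≤ b ∧ b ≤ P.bHi k + P.eb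

/-- **Region `k`** (holds the link box of every stride started from the enlarged core `k`). [cite: KozmaNitzan2024, §4 Lemma 11 (p. 22)] -/
def InRegion (k : ℕ) (a b : ℤ) : Prop :=
  P.aLo k - P.ea - P.La ≤ a ∧ a ≤ P.aHi k + P.ea + P.La ∧ P.bLo k - P.eb - P.Lb ≤ b ∧ b ≤ P.bHi k + P.eb + P.Lb

/-- The floor of the near edges: `min aLo0 (A + 1 − sHi)`. [this work] -/
def aBot : ℤ := min P.aLo0 (P.A + 1 - P.sHi)

/-- **The prism** (one box holding every region `k ≤ N`). [cite: KozmaNitzan2024, §4 Lemma 11 (p. 22: Ω)] -/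
def InPrism (a b : ℤ) : Prop :=
  P.aBot - P.ea - P.La ≤ a ∧ a ≤ P.A + (P.N : ℤ) * (P.ea + P.ρ) + P.ea + P.La ∧
    -(P.Wm : ℤ) - (P.N : ℤ) * P.g - P.eb - P.Lb ≤ b ∧ b ≤ (P.Wp : ℤ) + (P.N : ℤ) * P.g + P.eb + P.Lb

/-- **The steering sign at step `k`** from transverse position `b`: the lower piece iff `b` lies in the upper half of the window.
[cite: MartineauTassion2017, §4.3 Lemma 4.2] -/
def steer (k : ℕ) (b : ℤ) : ℤ := if P.bLo k + P.bHi k ≤ 2 * b then -1 else 1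

/-- **The landing piece of sign `τ`** as a transverse offset relative to the drifted position. [cite: MartineauTassion2017, §3.2] -/
def InPiece (τ δ : ℤ) : Prop := (τ = 1 → 0 ≤ δ ∧ δ ≤ P.Pp) ∧ (τ = -1 → -(P.Pm : ℤ) ≤ δ ∧ δ ≤ 0)

/-- **The far test**: a contact at along-position `a` of the enlarged core `k` PARKS (its stride could overshoot the far edge). [this work] -/
def IsFar (k : ℕ) (a : ℤ) : Prop := P.aHi k + P.ea + P.ρ - P.sHi < a

/-- The steering sign is `±1`. [folklore] -/
theorem steer_eq_or (k : ℕ) (b : ℤ) : ParkPrm.steer P k b = 1 ∨ ParkPrm.steer P k b = -1 := by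
  unfold steer; split_ifs <;> simp

/-- The steering sign is `−1` exactly in the upper half. [folklore] -/
theorem steer_eq_neg_one_iff (k : ℕ) (b : ℤ) : P.steer k b = -1 ↔ P.bLo k + P.bHi k ≤ 2 * b := by
  unfold steer
  split_ifs with h
  · exact ⟨fun _ => h, fun _ => rfl⟩
  · exact ⟨fun h' => absurd h' (by norm_num), fun h' => absurd h' h⟩

/-- The steering sign is `1` exactly in the lower half. [folklore] -/
theorem steer_eq_one_iff (k : ℕ) (b : ℤ) : P.steer k b = 1 ↔ 2 * b < P.bLo k + P.bHi k := by
  unfold steer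
  split_ifs with h
  · exact ⟨fun h' => absurd h' (by norm_num), fun h' => absurd h (not_le.2 h')⟩
  · exact ⟨fun _ => not_le.1 h, fun _ => rfl⟩

/-! ## §3 The route dichotomy and the containments -/

variable {P}

/-- A contact position is a seed-centre position. [folklore] -/
theorem inEnl_of_inCore {k : ℕ} {a b : ℤ} (h : ParkPrm.InCore P k a b) : ParkPrm.InEnl P k a b := by
  obtain ⟨h1, h2, h3, h4⟩ := h
  have hea : (0 : ℤ) ≤ P.ea := by positivity
  have heb : (0 : ℤ) ≤ P.eb := by positivity
  exact ⟨by linarith, by linarith, by linarith, by linarith⟩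

/-- The enlarged core lies in the region. [folklore] -/
theorem inRegion_of_inEnl {k : ℕ} {a b : ℤ} (h : ParkPrm.InEnl P k a b) : ParkPrm.InRegion P k a b := by
  obtain ⟨h1, h2, h3, h4⟩ := h
  have hLa : (0 : ℤ) ≤ P.La := by positivity
  have hLb : (0 : ℤ) ≤ P.Lb := by positivity
  exact ⟨by linarith, by linarith, by linarith, by linarith⟩

/-- **The link box of a stride from an enlarged-core point lies in the region.** [cite: KozmaNitzan2024, §4 Lemma 11 (p. 22)] -/
theorem inRegion_of_link {k : ℕ} {a b : ℤ} (hv : ParkPrm.InEnl P k a b) {a' b' : ℤ} (ha : |a' - a| ≤ P.La) (hb : |b' - b| ≤ P.Lb) :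
    ParkPrm.InRegion P k a' b' := by
  obtain ⟨h1, h2, h3, h4⟩ := hv
  rw [abs_le] at ha hb
  exact ⟨by linarith [ha.1], by linarith [ha.2], by linarith [hb.1], by linarith [hb.2]⟩

/-- The transverse window of core `k` has width at least `Wm + Wp`. [folklore] -/
theorem window_width (k : ℕ) : (P.Wm : ℤ) + P.Wp ≤ P.bHi k - P.bLo k := by
  unfold bHi bLo
  have hg : (0 : ℤ) ≤ P.g := by positivity
  have hk : (0 : ℤ) ≤ k := by positivity
  nlinarith

/-- **FAR CONTACTS PARK**: from a seed centre `(a, b)` of the enlarged core `k` beyond the far threshold, the whole face box `[a − ρ, a + ρ] × [b − ρ, b + ρ]`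
lies in core `k + 1`. [this work] -/
theorem box_subset_of_isFar {k : ℕ} {a b : ℤ} (hv : P.InEnl k a b) (hfar : P.IsFar k a) {a' b' : ℤ} (ha : |a' - a| ≤ P.ρ)
    (hb : |b' - b| ≤ P.ρ) : P.InCore (k + 1) a' b' := by
  obtain ⟨h1, h2, h3, h4⟩ := hv
  unfold IsFar at hfar
  rw [abs_le] at ha hb
  have hg := P.g_eq
  have hd0 : (0 : ℤ) ≤ |P.d| := abs_nonneg _
  refine ⟨?_, ?_, ?_, ?_⟩
  · rw [aLo_succ]; refine le_trans (min_le_right _ _) ?_; linarith [ha.1]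
  · rw [aHi_succ]; linarith [ha.2]
  · rw [bLo_succ]; linarith [hb.1]
  · rw [bHi_succ]; linarith [hb.2]

/-- **STRIDERS LAND IN THE NEXT CORE**: from a seed centre `(a, b)` of the enlarged core `k` NOT beyond the far threshold, every landing point — along
progress in `[sLo, sHi]`, transverse offset (relative to the drift `d`) in the piece of sign `steer k b` — lies in core `k + 1`.
[cite: MartineauTassion2017, §4.3 Lemma 4.2] [cite: KozmaNitzan2024, §4 Lemma 11 (pp. 22–23)] -/
theorem inCore_succ_of_landing (hP : ParkOK P) {k : ℕ} {a b : ℤ} (hv : P.InEnl k a b) (hfar : ¬P.IsFar k a) {a' b' : ℤ}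
    (ha1 : P.sLo ≤ a' - a) (ha2 : a' - a ≤ P.sHi) (hb : P.InPiece (P.steer k b) (b' - b - P.d)) : P.InCore (k + 1) a' b' := by
  obtain ⟨h1, h2, h3, h4⟩ := hv
  have hfar' : a ≤ P.aHi k + P.ea + P.ρ - P.sHi := not_lt.1 hfar
  have hg := P.g_eq
  have hd0 : (0 : ℤ) ≤ |P.d| := abs_nonneg _
  have hdl : -|P.d| ≤ P.d := neg_abs_le P.d
  have hdu : P.d ≤ |P.d| := le_abs_self P.d
  have hPm : (2 : ℤ) * P.Pm ≤ P.Wm + P.Wp := by exact_mod_cast hP.hPm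
  have hPp : (2 : ℤ) * P.Pp ≤ P.Wm + P.Wp := by exact_mod_cast hP.hPp
  have hww := P.window_width k
  refine ⟨?_, ?_, ?_, ?_⟩
  · rw [aLo_succ]; refine le_trans (min_le_left _ _) ?_; linarith
  · rw [aHi_succ]; linarith
  · -- lower transverse bound
    rw [bLo_succ]
    rcases P.steer_eq_or k b with hτ | hτ
    · have hlt := (P.steer_eq_one_iff k b).1 hτ
      have hδ := hb.1 hτ
      linarith [hδ.1]
    · have hge := (P.steer_eq_neg_one_iff k b).1 hτ
      have hδ := hb.2 hτ
      linarith [hδ.1]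
  · -- upper transverse bound
    rw [bHi_succ]
    rcases P.steer_eq_or k b with hτ | hτ
    · have hlt := (P.steer_eq_one_iff k b).1 hτ
      have hδ := hb.1 hτ
      linarith [hδ.2]
    · have hge := (P.steer_eq_neg_one_iff k b).1 hτ
      have hδ := hb.2 hτ
      linarith [hδ.2]

/-- **THE ROUTE DICHOTOMY of the parking phase**: from every seed centre of the enlarged core `k`, the link box lies in region `k`, and EITHER the contact
is far and its face box lies in core `k + 1`, OR it is not and its steered landing lies in core `k + 1`. [cite: KozmaNitzan2024, §4 Lemma 12 (pp. 23–25)]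
[cite: MartineauTassion2017, §4.3 Lemma 4.2] -/
theorem route (hP : ParkOK P) {k : ℕ} {a b : ℤ} (hv : P.InEnl k a b) :
    (∀ a' b' : ℤ, |a' - a| ≤ P.La → |b' - b| ≤ P.Lb → P.InRegion k a' b') ∧
      (P.IsFar k a → ∀ a' b' : ℤ, |a' - a| ≤ P.ρ → |b' - b| ≤ P.ρ → P.InCore (k + 1) a' b') ∧
      (¬P.IsFar k a → ∀ a' b' : ℤ, P.sLo ≤ a' - a → a' - a ≤ P.sHi → P.InPiece (P.steer k b) (b' - b - P.d) → P.InCore (k + 1) a' b') :=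
  ⟨fun _ _ ha hb => inRegion_of_link hv ha hb, fun hfar _ _ ha hb => box_subset_of_isFar hv hfar ha hb,
    fun hfar _ _ ha1 ha2 hb => inCore_succ_of_landing hP hv hfar ha1 ha2 hb⟩

/-- The near edges stay above the floor `aBot`. [folklore] -/
theorem aBot_le_aLo (hP : ParkOK P) : ∀ k, P.aBot ≤ P.aLo k
  | 0 => by simp [aBot]
  | k + 1 => by
    rw [aLo_succ]
    have ih := aBot_le_aLo hP k
    have hea := hP.hea
    have hA : P.A ≤ P.aHi k := by
      unfold aHi
      have : (0 : ℤ) ≤ (k : ℤ) * (P.ea + P.ρ) := by positivity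
      linarith
    have hb2 : P.aBot ≤ P.A + 1 - P.sHi := min_le_right _ _
    refine le_min (by linarith) ?_
    have : (0 : ℤ) ≤ P.ea := by positivity
    linarith

/-- **The next core lies in the region.** [cite: KozmaNitzan2024, §4 Lemma 11 (p. 22)] -/
theorem inRegion_of_inCore_succ (hP : ParkOK P) {k : ℕ} {a b : ℤ} (h : P.InCore (k + 1) a b) (hne : P.aLo k ≤ P.aHi k) :
    P.InRegion k a b := by
  obtain ⟨h1, h2, h3, h4⟩ := h
  rw [aLo_succ] at h1
  rw [aHi_succ] at h2
  rw [bLo_succ] at h3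
  rw [bHi_succ] at h4
  have hsL := hP.hsL; have hρa := hP.hρa; have hρd := hP.hρd; have hs1 := hP.hs1; have hs0 := hP.hs0; have hea := hP.hea
  have hLa : (P.ρ : ℤ) ≤ P.La := by exact_mod_cast hρa
  have hg := P.g_eq
  refine ⟨?_, by linarith, ?_, ?_⟩
  · -- the near edge of core k+1 is at least the near edge of core k minus nothing, or one stride below the far edge
    rcases le_total (P.aLo k + P.sLo - P.ea) (P.aHi k + P.ea + 1 - P.sHi) with hc | hc
    · rw [min_eq_left hc] at h1
      have : (0 : ℤ) ≤ P.La := by positivity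
      linarith
    · rw [min_eq_right hc] at h1
      have hsLz : P.sHi ≤ (P.La : ℤ) := by exact_mod_cast hsL
      linarith
  · rw [hg] at h3; linarith
  · rw [hg] at h4; linarith

/-- **Every region `k ≤ N` lies in the prism.** [cite: KozmaNitzan2024, §4 Lemma 11 (p. 22: Ω)] -/
theorem inPrism_of_inRegion (hP : ParkOK P) {k : ℕ} (hk : k ≤ P.N) {a b : ℤ} (h : P.InRegion k a b) : P.InPrism a b := by
  obtain ⟨h1, h2, h3, h4⟩ := h
  have hbot := aBot_le_aLo hP k
  have hk0 : (0 : ℤ) ≤ k := by positivity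
  have hkN : (k : ℤ) ≤ P.N := by exact_mod_cast hk
  have hep : (0 : ℤ) ≤ P.ea + P.ρ := by positivity
  have hg0 : (0 : ℤ) ≤ P.g := by positivity
  have hkm : (k : ℤ) * (P.ea + P.ρ) ≤ (P.N : ℤ) * (P.ea + P.ρ) := mul_le_mul_of_nonneg_right hkN hep
  have hkg : (k : ℤ) * P.g ≤ (P.N : ℤ) * P.g := mul_le_mul_of_nonneg_right hkN hg0
  simp only [InPrism, aHi, bLo, bHi] at h2 h3 h4 ⊢
  exact ⟨by linarith, by linarith, by linarith, by linarith⟩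

/-- **The cores are nonempty**: `aLo k ≤ aHi k` and the window is nonempty, so the far upper corner `(aHi k, bHi k)` lies in core `k`. [folklore] -/
theorem aLo_le_aHi (hP : ParkOK P) : ∀ k, P.aLo k ≤ P.aHi k
  | 0 => by simpa using hP.h0
  | k + 1 => by
    rw [aLo_succ, aHi_succ]
    have hs1 := hP.hs1
    refine le_trans (min_le_right _ _) ?_
    have : (0 : ℤ) ≤ P.ρ := by positivity
    linarith

/-- The far upper corner of core `k` lies in core `k`. [folklore] -/
theorem inCore_far_corner (hP : ParkOK P) (k : ℕ) : P.InCore k (P.aHi k) (P.bHi k) := by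
  refine ⟨aLo_le_aHi hP k, le_rfl, ?_, le_rfl⟩
  have := P.window_width k
  have : (0 : ℤ) ≤ P.Wm + P.Wp := by positivity
  linarith

/-- Core `0` is the start box `[aLo0, A] × [−Wm, Wp]`. [folklore] -/
theorem inCore_zero_iff (a b : ℤ) : P.InCore 0 a b ↔ P.aLo0 ≤ a ∧ a ≤ P.A ∧ -(P.Wm : ℤ) ≤ b ∧ b ≤ P.Wp := by
  unfold InCore bLo bHi; simp [aHi]

/-! ## §4 The along-extent contracts -/

/-- **One step of the extent recursion**: `aHi (k+1) − aLo (k+1) = max (aHi k − aLo k + 2ea + ρ − sLo) (sHi + ρ − 1)`. [this work] -/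
theorem extent_succ (k : ℕ) :
    P.aHi (k + 1) - P.aLo (k + 1) = max (P.aHi k - P.aLo k + 2 * P.ea + P.ρ - P.sLo) (P.sHi + P.ρ - 1) := by
  rw [aHi_succ, aLo_succ]
  rcases le_total (P.aLo k + P.sLo - P.ea) (P.aHi k + P.ea + 1 - P.sHi) with hc | hc
  · rw [min_eq_left hc, max_eq_left (by linarith)]; ring
  · rw [min_eq_right hc, max_eq_right (by linarith)]; ring

/-- **THE ALONG-EXTENT OF THE CORES CONTRACTS** by `sLo − 2ea − ρ` per step down to `sHi + ρ − 1`: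
`aHi k − aLo k ≤ max (A − aLo0 − k·(sLo − 2ea − ρ)) (sHi + ρ − 1)`. [this work] -/
theorem extent_le (hP : ParkOK P) :
    ∀ k : ℕ, P.aHi k - P.aLo k ≤ max (P.A - P.aLo0 - (k : ℤ) * (P.sLo - 2 * P.ea - P.ρ)) (P.sHi + P.ρ - 1)
  | 0 => by simp
  | k + 1 => by
    rw [extent_succ]
    have ih := extent_le hP k
    have hc : (0 : ℤ) ≤ P.sLo - 2 * P.ea - P.ρ := by have := hP.hcontr; linarith
    push_cast
    refine max_le ?_ (le_max_right _ _)
    rcases le_max_iff.1 ih with h | h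
    · exact le_trans (by linarith) (le_max_left _ _)
    · exact le_trans (by linarith) (le_max_right _ _)

/-- **Parked after enough steps**: if `A − aLo0 ≤ sHi + ρ − 1 + k·(sLo − 2ea − ρ)` then `aHi k − aLo k ≤ sHi + ρ − 1` (the cores have shrunk to one
stride plus the face radius). [this work] -/
theorem extent_le_of_steps (hP : ParkOK P) {k : ℕ} (hk : P.A - P.aLo0 ≤ P.sHi + P.ρ - 1 + (k : ℤ) * (P.sLo - 2 * P.ea - P.ρ)) :
    P.aHi k - P.aLo k ≤ P.sHi + P.ρ - 1 := by
  have h := extent_le hP k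
  rcases le_max_iff.1 h with h1 | h1
  · linarith
  · exact h1

end ParkPrm

end ChainPara

end Summit.CriticalPhenomena.PercolationContinuityZ3.Theorems.Transplant
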